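import Summits.QuantumFields.BalabanUV.Beta.GAN24.AliasWeights

/-!
# `BalabanUV.Beta.GAN24.AliasWeightsClosedForm` — binder row G-an2-4 / (CONV-C), road P1-fibre, leaf **P1-L06** (node A2 / N06 of
# `SKELETON-P1.md`), part 3: the CLOSED FORM of the block-average weights and its two consequences at the alias momenta

NOT IN PRINT; OUR PROOF ATTEMPT.  HONEST FRAMING (cell contract, verbatim): «discharging `BetaPertH` makes Bałaban's UV stability
UNCONDITIONAL — a real constructive-QFT result; it is NOT the continuum limit and NOT the Clay problem.»  HONEST DEPENDENCY (verbatim):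
«continuum YM on T⁴ ⇐ BetaPertH ∧ nine spine estimates (0/9 proved); BetaPertH ⇐ (D1) ∧ (D4) ∧ CAP+tail; G-an2-4 gates asym, D1 and
NE2/3/4.»  [folklore] explicit analysis; discharges NOTHING of (CONV-C) by itself (weight bookkeeping for leaves P1-L05(b)/L08/L09/L11).
NOT `BetaPertH`, NOT continuum, NOT Clay.  No definition, no `def … : Prop`, no cited fact, no wall binder.

## What is proved (Mathlib + `GAN24/AliasWeights`; `G(x,N) = Σ_{t<N} e^{ixt}` on the explicit `Finset.range` sum as in part 1)
* `norm_geomExp_mul_two_abs_sin`: `‖G(x,N)‖·2|sin(x/2)| = 2|sin(Nx/2)|` (all real `x`) and the CLOSED FORM `norm_geomExp_eq_div`: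
  `‖G(x,N)‖ = |sin(Nx/2)|/|sin(x/2)|` (`sin(x/2) ≠ 0`);
* `abs_sin_mul_kfin_div_two`: at an alias momentum `k = (p + 2πr)/N`, `r ∈ ℤ`, the numerator is `|sin(N k/2)| = |sin(p/2)|` —
  INDEPENDENT of the alias; `norm_geomExp_kfin_mul_abs_sin`: `‖G(k,N)‖·|sin(k/2)| = |sin(p/2)|`;
* **`two_div_pi_mul_le_norm_geomExp`**: the `m = 0` block weight is of order `N`: `(2/π)·N ≤ ‖G(p/N, N)‖` for `|p| ≤ π`, `N ≥ 1`
  (with `‖G(p/N,N)‖ ≤ N` of part 1: `|S(0)|²` is comparable to `N^{2D}` UNIFORMLY on the zone — the leading term of SKELETON-P1 A4′(i));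
* **`norm_geomExp_kfin_mul_fold_le`** (′): the KING-TYPE WEIGHT of a nonzero alias coordinate, `‖G((p+2πr)/N, N)‖·min(r, N−r) ≤ N·|sin(p/2)|
  ≤ N·|p|/2` for `|p| ≤ π`, `1 ≤ r ≤ N − 1` — every active alias coordinate carries a factor `|sin(p_i/2)| ≤ |p_i|/2` that VANISHES at
  `p → 0` (the structure `|S_m|² ≈ N^{2D} Π_{i : m_i ≠ 0} p_i²/(2πm_i)²` of SKELETON-P1 A4′, cf. King 1986 (4.20) `Π_μ |p′_μ| |(p′+l)_μ|⁻¹`).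

Unit `b2b-balaban-gan24-formalise-leaf-17` (G-an2-4 formalisation swarm, leaf prover 17), 2026-08-19.  Value = kernel bookkeeping leaf
toward the K-slot route P1, NOT summit progress.
-/

noncomputable section

open Complex Finset
open scoped BigOperators Real

namespace Summit.QuantumFields.BalabanUV.Beta.GAN24.AliasWeightsClosedForm

open AliasWeights

/-! ## The CLOSED FORM of the weights: `‖G(x,N)‖ = |sin(Nx/2)|/|sin(x/2)|`; at the alias momenta the numerator is
`|sin(p/2)|`, INDEPENDENT of the alias — so the `m = 0` block weight is comparable to `N` (`(2/π)N ≤ ‖G(p/N,N)‖ ≤ N` on the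
Brillouin zone) and every NONZERO alias carries the King-type factor `|sin(p/2)| ≤ |p|/2`, vanishing at `p → 0`
(SKELETON-P1 A4′: `|S_m|² ≈ N^{2D} Π_{i : m_i ≠ 0} p_i²/(2πm_i)²`). -/

/-- [folklore] Norm form of the geometric-sum identity for real `x`: `‖G(x,N)‖ · 2|sin(x/2)| = 2|sin(Nx/2)|`. -/
theorem norm_geomExp_mul_two_abs_sin (x : ℝ) (N : ℕ) :
    ‖∑ t ∈ Finset.range N, cexp (I * x * t)‖ * (2 * |Real.sin (x / 2)|) = 2 * |Real.sin (N * x / 2)| := by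
  have hid := geomExp_mul_sub_one (x : ℂ) N
  have h1 : ‖cexp (I * x) - 1‖ = 2 * |Real.sin (x / 2)| := by
    rw [Complex.norm_exp_I_mul_ofReal_sub_one, Real.norm_eq_abs, abs_mul, abs_two]
  have h2 : ‖cexp (I * x * N) - 1‖ = 2 * |Real.sin (N * x / 2)| := by
    rw [show I * (x : ℂ) * (N : ℂ) = I * ((N * x : ℝ) : ℂ) by push_cast; ring, Complex.norm_exp_I_mul_ofReal_sub_one,
      Real.norm_eq_abs, abs_mul, abs_two]
  rw [← h1, ← norm_mul, hid, h2]

/-- [folklore] **Closed form** `‖G(x,N)‖ = |sin(Nx/2)| / |sin(x/2)|` for real `x` with `sin(x/2) ≠ 0`. -/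
theorem norm_geomExp_eq_div (x : ℝ) (N : ℕ) (hx : Real.sin (x / 2) ≠ 0) :
    ‖∑ t ∈ Finset.range N, cexp (I * x * t)‖ = |Real.sin (N * x / 2)| / |Real.sin (x / 2)| := by
  have hs : 0 < |Real.sin (x / 2)| := abs_pos.2 hx
  have h := norm_geomExp_mul_two_abs_sin x N
  rw [eq_div_iff hs.ne']
  linarith

/-- [folklore] At an alias momentum `k = (p + 2πr)/N` (`r ∈ ℤ`, `N ≠ 0`) the numerator does not see the alias:
`|sin(N·k/2)| = |sin(p/2)|`. -/
theorem abs_sin_mul_kfin_div_two (p : ℝ) (r : ℤ) {N : ℕ} (hN : N ≠ 0) :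
    |Real.sin (N * ((p + 2 * π * r) / N) / 2)| = |Real.sin (p / 2)| := by
  have hN' : (N : ℝ) ≠ 0 := by exact_mod_cast hN
  have e : (N : ℝ) * ((p + 2 * π * r) / N) / 2 = p / 2 + r * π := by field_simp
  rw [e, Real.sin_add_int_mul_pi, abs_mul, abs_zpow, abs_neg, abs_one, one_zpow, one_mul]

/-- [folklore] Hence at every alias momentum `k = (p + 2πr)/N`: `‖G(k,N)‖ · |sin(k/2)| = |sin(p/2)|` (no hypothesis on `r`). -/
theorem norm_geomExp_kfin_mul_abs_sin (p : ℝ) (r : ℤ) {N : ℕ} (hN : N ≠ 0) :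
    ‖∑ t ∈ Finset.range N, cexp (I * ((p + 2 * π * r) / N : ℝ) * t)‖ * |Real.sin ((p + 2 * π * r) / N / 2)|
      = |Real.sin (p / 2)| := by
  have h := norm_geomExp_mul_two_abs_sin ((p + 2 * π * r) / N) N
  rw [abs_sin_mul_kfin_div_two p r hN] at h
  linarith

/-- [folklore] **The `m = 0` block weight is of order `N`**: `(2/π)·N ≤ ‖G(p/N, N)‖` for `|p| ≤ π`, `N ≥ 1`
(with `‖G(p/N,N)‖ ≤ N` from `norm_geomExp_le`: `|S(0)|² = Π_i ‖G(p_i/N,N)‖²` is comparable to `N^{2D}` uniformly on the zone). -/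
theorem two_div_pi_mul_le_norm_geomExp {p : ℝ} (hp : |p| ≤ π) {N : ℕ} (hN : 1 ≤ N) :
    2 / π * N ≤ ‖∑ t ∈ Finset.range N, cexp (I * (p / N : ℝ) * t)‖ := by
  have hπ := Real.pi_pos
  have hN0 : N ≠ 0 := by omega
  have hNr : (0 : ℝ) < N := by exact_mod_cast (by omega : 0 < N)
  rcases eq_or_ne p 0 with rfl | hp0
  · -- G(0, N) = N
    have h1 : ∀ t ∈ Finset.range N, cexp (I * ((0 : ℝ) / N : ℝ) * t) = 1 := fun t _ => by simp
    rw [Finset.sum_congr rfl h1, Finset.sum_const, Finset.card_range, nsmul_eq_mul, mul_one, Complex.norm_natCast]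
    have : 2 / π ≤ 1 := by rw [div_le_one hπ]; linarith [Real.pi_gt_three]
    nlinarith
  · have hpabs : 0 < |p| := abs_pos.2 hp0
    -- sin(p/(2N)) ≠ 0 and |sin(p/(2N))| ≤ |p|/(2N)
    have hsmall : |Real.sin (p / N / 2)| ≤ |p| / (2 * N) := by
      have h := Real.abs_sin_le_abs (x := p / N / 2)
      have e : |p / (N : ℝ) / 2| = |p| / (2 * N) := by
        rw [abs_div, abs_div, abs_of_pos hNr, abs_two]
        ring
      rw [e] at h
      exact h
    have hne : Real.sin (p / N / 2) ≠ 0 := by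
      intro h0
      have hlt : -π < p / N / 2 ∧ p / N / 2 < π := by
        have hp1 := (abs_le.1 hp).1
        have hp2 := (abs_le.1 hp).2
        have hN1 : (1 : ℝ) ≤ N := by exact_mod_cast hN
        constructor
        · rw [div_div, lt_div_iff₀ (by positivity)]; nlinarith
        · rw [div_div, div_lt_iff₀ (by positivity)]; nlinarith
      have := (Real.sin_eq_zero_iff_of_lt_of_lt hlt.1 hlt.2).1 h0
      have : p = 0 := by
        field_simp at this
        simpa using this
      exact hp0 this
    have hs : 0 < |Real.sin (p / N / 2)| := abs_pos.2 hne
    -- closed form with r = 0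
    have hcf := norm_geomExp_kfin_mul_abs_sin p 0 hN0
    simp only [Int.cast_zero, mul_zero, add_zero] at hcf
    -- Jordan on the zone: |p|/π ≤ |sin(p/2)|  (a landed copy of this step lives in a lace-expansion module of
    -- `Literature/Barriers/CriticalPhenomena`; it is re-derived inline here rather than importing that closure)
    have hnum : |p| / π ≤ |Real.sin (p / 2)| := by
      have key : ∀ q : ℝ, 0 ≤ q → q ≤ π → q / π ≤ Real.sin (q / 2) := by
        intro q hq0 hqπ
        have h := Real.mul_le_sin (by linarith : 0 ≤ q / 2) (by linarith : q / 2 ≤ π / 2)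
        calc q / π = 2 / π * (q / 2) := by field_simp
          _ ≤ Real.sin (q / 2) := h
      rcases le_total 0 p with h0 | h0
      · rw [abs_of_nonneg h0] at hp ⊢
        exact (key p h0 hp).trans (le_abs_self _)
      · rw [abs_of_nonpos h0] at hp ⊢
        have h := key (-p) (by linarith) hp
        rw [show -p / 2 = -(p / 2) by ring, Real.sin_neg] at h
        exact h.trans (neg_le_abs _)
    -- ‖G‖ ≥ (|p|/π) / (|p|/(2N)) = 2N/π
    have hG : |p| / π ≤ ‖∑ t ∈ Finset.range N, cexp (I * (p / N : ℝ) * t)‖ * (|p| / (2 * N)) := by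
      calc |p| / π ≤ |Real.sin (p / 2)| := hnum
        _ = ‖∑ t ∈ Finset.range N, cexp (I * (p / N : ℝ) * t)‖ * |Real.sin (p / N / 2)| := hcf.symm
        _ ≤ ‖∑ t ∈ Finset.range N, cexp (I * (p / N : ℝ) * t)‖ * (|p| / (2 * N)) :=
            mul_le_mul_of_nonneg_left hsmall (norm_nonneg _)
    have h2 : |p| / π = (2 / π * N) * (|p| / (2 * N)) := by field_simp
    rw [h2] at hG
    exact le_of_mul_le_mul_right hG (by positivity)

/-- [folklore] **King-type weight of a NONZERO alias coordinate** (the structure `|S_m|² ≈ N^{2D} Π_{i: m_i ≠ 0} p_i²/(2πm_i)²` of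
SKELETON-P1 A4′): for `|p| ≤ π`, `1 ≤ r ≤ N − 1`, `‖G((p + 2πr)/N, N)‖ · min(r, N − r) ≤ N · |sin(p/2)|` — the alias weight carries the
factor `|sin(p/2)| ≤ |p|/2`, which VANISHES at `p → 0`. -/
theorem norm_geomExp_kfin_mul_fold_le {p : ℝ} (hp : |p| ≤ π) {N r : ℕ} (hr : 1 ≤ r) (hrN : r + 1 ≤ N) :
    ‖∑ t ∈ Finset.range N, cexp (I * ((p + 2 * π * r) / N : ℝ) * t)‖ * ((min r (N - r) : ℕ) : ℝ)
      ≤ N * |Real.sin (p / 2)| := by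
  have hN0 : N ≠ 0 := by omega
  have hfold := fold_le_mul_abs_sin hp hr hrN
  have hcf := norm_geomExp_kfin_mul_abs_sin p (r : ℤ) hN0
  simp only [Int.cast_natCast] at hcf
  calc ‖∑ t ∈ Finset.range N, cexp (I * ((p + 2 * π * r) / N : ℝ) * t)‖ * ((min r (N - r) : ℕ) : ℝ)
      ≤ ‖∑ t ∈ Finset.range N, cexp (I * ((p + 2 * π * r) / N : ℝ) * t)‖
          * ((N : ℝ) * |Real.sin ((p + 2 * π * r) / N / 2)|) := mul_le_mul_of_nonneg_left hfold (norm_nonneg _)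
    _ = N * |Real.sin (p / 2)| := by rw [← mul_assoc, mul_comm _ (N : ℝ), mul_assoc, hcf]

/-- [folklore] The same with `|sin(p/2)| ≤ |p|/2`: `‖G((p+2πr)/N, N)‖ · min(r, N − r) ≤ N·|p|/2`. -/
theorem norm_geomExp_kfin_mul_fold_le' {p : ℝ} (hp : |p| ≤ π) {N r : ℕ} (hr : 1 ≤ r) (hrN : r + 1 ≤ N) :
    ‖∑ t ∈ Finset.range N, cexp (I * ((p + 2 * π * r) / N : ℝ) * t)‖ * ((min r (N - r) : ℕ) : ℝ) ≤ N * (|p| / 2) := by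
  refine (norm_geomExp_kfin_mul_fold_le hp hr hrN).trans (mul_le_mul_of_nonneg_left ?_ (Nat.cast_nonneg N))
  have := Real.abs_sin_le_abs (x := p / 2)
  rwa [abs_div, abs_two] at this

end Summit.QuantumFields.BalabanUV.Beta.GAN24.AliasWeightsClosedForm

end
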